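import Mathlib
import Summits.NavierStokesRegularity.NavierStokesRegularity.Theorems.EulerZoomLiouvillePowerGaugeEulerLiouvilleNeedleFastTime
import HarnessLib.Audit

/-!
# Crux E `EulerZoomLiouville.PowerGaugeEulerLiouville` — THE CLOCK REDUCTION (ROUND-39 (CR)): under a Bernoulli
# oscillation bound, a HOVERING LAW for the labels that linger near the nodal set is already an EFFECTIVE CLOCK

Route №10 `EulerZoomLiouville` (NavierStokesRegularity), crux E = stmt-NavierStokesRegularity-19832, registered residue
`stub_selfSimilarC2Needle`; memo ROUND-39 «THE CLOCK IS THE EFFECTIVE CONFINEMENT THEOREM» of the cell `ns-regularity-ideate`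
(text custody nsreg-p2 g33; signature sheet `r39/Sketch39.lean` v1.1, Prop `ClockReduction` with the room condition of option (a)).
By-name assembly over the planner's FAST-TIME BOUND (t39f, `NeedleClock.volume_fastTime_le_of_linger`: along a backward
cut-off orbit that lingers in `B̄_M` the time spent where `‖W‖ ≥ δ` is `≤ (ℋ(end) − ℋ(start))/((1−2γ)δ²)`):

* `nonneg_of_bernoulliOsc` — an oscillation bound `osc_{B̄_r} ℋ ≤ C r^θ` (`r ≥ 1`) has `C ≥ 0`;
* **`effectiveClock_of_hoveringLaw`** — `(U, P)` a `C²` self-similar Euler profile with `γ < ½`; BERNOULLI OSCILLATION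
  `ℋ(y) − ℋ(y') ≤ C r^θ` on `B̄_r` (`r ≥ 1`); a scale `δ(R) > 0` (`R ≥ 1`) with the ROOM CONDITION
  `2^{2+θ} C R^θ ≤ (1−2γ) c′ δ(R)² R^e` for large `R`; and the HOVERING LAW at strength `c′R^e` — around every vortical point a
  ball `B` such that for all large `R` and every `C²` cut-off copy `V` of `U` beyond `2R`, the labels of `B` that LINGER in
  `‖·‖ ≤ 2R` during backward time `L = c′R^e` AND spend at least half of `[0, L]` where `‖W_V‖ < δ(R)` have volume `≤ |B|/4`.
  THEN the EFFECTIVE CLOCK of strength `c′R^e` holds (lingering labels `≤ |B|/2`) — the `hclock` hypothesis of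
  `NeedleRace.curl_eq_zero_of_powerClock_of_strongThinExits` / `…_of_subcriticalClockC2` (`e = 2+ρ`).  Proof: by the fast-time
  bound and the oscillation bound a lingering label is fast (‖W‖ ≥ δ) for at most `2^θ C R^θ/((1−2γ)δ²) ≤ L/4` of `[0, L]`, so it
  hovers; monotonicity of the measure.

NOT NS, not E: a reduction inside THE ONE STATEMENT's portrait (the hovering law is the open clock); 19832 OPEN.
References: Constantin–Ignatova–Vicol arXiv:2602.17570 §3.4 (3.31) [ConstantinIgnatovaVicol2026Putative]; (Chebyshev in time) [folklore].
-/

noncomputable section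

-- the summit and its single problem share the name `NavierStokesRegularity` (D-0017 nested layout)
set_option linter.dupNamespace false

open Set Filter Topology Metric Function MeasureTheory InnerProductSpace
open scoped RealInnerProductSpace NNReal ENNReal

namespace Summit.NavierStokesRegularity.NavierStokesRegularity.Theorems.PowerGaugeEulerLiouville.NeedleRace

open Literature.Analysis Literature.Analysis.FluidPDE
open Summit.NavierStokesRegularity.NavierStokesRegularity.Theorems.PowerGaugeEulerLiouville

variable {γ : ℝ} {U : EuclideanSpace ℝ (Fin 3) → EuclideanSpace ℝ (Fin 3)} {P : EuclideanSpace ℝ (Fin 3) → ℝ}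

/-- A Bernoulli oscillation bound `ℋ(y) − ℋ(y') ≤ C r^θ` on `B̄_r`, `r ≥ 1`, forces `C ≥ 0` (take `y = y' = 0`, `r = 1`). [folklore] -/
theorem nonneg_of_bernoulliOsc {C θ : ℝ}
    (hosc : ∀ r : ℝ, 1 ≤ r → ∀ y y' : EuclideanSpace ℝ (Fin 3), ‖y‖ ≤ r → ‖y'‖ ≤ r →
      selfSimilarBernoulli γ 0 U P y - selfSimilarBernoulli γ 0 U P y' ≤ C * r ^ θ) : 0 ≤ C := by
  have h := hosc 1 le_rfl 0 0 (by simp) (by simp)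
  simpa using h

/-- **THE CLOCK REDUCTION (ROUND-39 (CR), Sketch39 v1.1 `ClockReduction`).**  See the module docstring: Bernoulli oscillation
`≤ C r^θ` + room condition `2^{2+θ} C R^θ ≤ (1−2γ) c′ δ(R)² R^e` eventually + hovering law at strength `c′R^e` and scale `δ`
⇒ effective clock at strength `c′R^e`. [cite: ConstantinIgnatovaVicol2026Putative, §3.4.2 eq. (3.31)] -/
theorem effectiveClock_of_hoveringLaw (hprof : IsSelfSimilarEulerProfile γ 0 U P) (hγ2 : γ < 1 / 2)
    {θ C c' e : ℝ} (hc' : 0 < c')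
    (hosc : ∀ r : ℝ, 1 ≤ r → ∀ y y' : EuclideanSpace ℝ (Fin 3), ‖y‖ ≤ r → ‖y'‖ ≤ r →
      selfSimilarBernoulli γ 0 U P y - selfSimilarBernoulli γ 0 U P y' ≤ C * r ^ θ)
    {δ : ℝ → ℝ} (hδ : ∀ R : ℝ, 1 ≤ R → 0 < δ R)
    (hroom : ∃ R₁ : ℝ, ∀ R : ℝ, R₁ ≤ R → (2 : ℝ) ^ (2 + θ) * C * R ^ θ ≤ (1 - 2 * γ) * c' * δ R ^ 2 * R ^ e)
    (hhover : ∀ x₀ : EuclideanSpace ℝ (Fin 3), curl U x₀ ≠ 0 → ∃ r : ℝ, 0 < r ∧ ∃ R₀ : ℝ, ∀ R : ℝ, R₀ ≤ R →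
      ∀ (V : EuclideanSpace ℝ (Fin 3) → EuclideanSpace ℝ (Fin 3)) (K Rbig : ℝ), ContDiff ℝ 2 V →
        (∀ y, ‖fderiv ℝ V y‖ ≤ K) → 2 * R < Rbig → (∀ w ∈ ball (0 : EuclideanSpace ℝ (Fin 3)) Rbig, V w = U w) →
        (volume (ball x₀ r ∩ {a | ∀ σ ∈ Icc 0 (c' * R ^ e),
            ‖ODE.evolutionMap (fun _ : ℝ => selfSimilarTransport γ 0 V) 0 (-σ) a‖ ≤ 2 * R} ∩
          {a | c' * R ^ e / 2 ≤ (volume {σ ∈ Icc 0 (c' * R ^ e) |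
            ‖selfSimilarTransport γ 0 V (ODE.evolutionMap (fun _ : ℝ => selfSimilarTransport γ 0 V) 0 (-σ) a)‖ <
              δ R}).toReal})).toReal ≤ (volume (ball x₀ r)).toReal / 4) :
    ∀ x₀ : EuclideanSpace ℝ (Fin 3), curl U x₀ ≠ 0 → ∃ r : ℝ, 0 < r ∧ ∃ R₀ : ℝ, ∀ R : ℝ, R₀ ≤ R →
      ∀ (V : EuclideanSpace ℝ (Fin 3) → EuclideanSpace ℝ (Fin 3)) (K Rbig : ℝ), ContDiff ℝ 2 V →
        (∀ y, ‖fderiv ℝ V y‖ ≤ K) → 2 * R < Rbig → (∀ w ∈ ball (0 : EuclideanSpace ℝ (Fin 3)) Rbig, V w = U w) →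
        (volume (ball x₀ r ∩ {a | ∀ σ ∈ Icc 0 (c' * R ^ e),
            ‖ODE.evolutionMap (fun _ : ℝ => selfSimilarTransport γ 0 V) 0 (-σ) a‖ ≤ 2 * R})).toReal ≤
          (volume (ball x₀ r)).toReal / 2 := by
  have h12 : 0 < 1 - 2 * γ := by linarith
  intro x₀ hx₀
  obtain ⟨r, hr, R₀, hR₀⟩ := hhover x₀ hx₀
  obtain ⟨R₁, hR₁⟩ := hroom
  refine ⟨r, hr, max R₀ (max R₁ 1), fun R hR V K Rbig hV2 hK hRbig hVU => ?_⟩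
  have hRR₀ : R₀ ≤ R := (le_max_left _ _).trans hR
  have hRR₁ : R₁ ≤ R := ((le_max_left _ _).trans (le_max_right _ _)).trans hR
  have hR1 : 1 ≤ R := ((le_max_right _ _).trans (le_max_right _ _)).trans hR
  have hR0 : 0 < R := by linarith
  have hV1 : ContDiff ℝ 1 V := hV2.of_le (by norm_num)
  set L : ℝ := c' * R ^ e with hL
  have hL0 : 0 ≤ L := mul_nonneg hc'.le (Real.rpow_nonneg hR0.le _)
  set Φ := ODE.evolutionMap (fun _ : ℝ => selfSimilarTransport γ 0 V) 0 with hΦ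
  set B : Set (EuclideanSpace ℝ (Fin 3)) := ball x₀ r with hB
  set Linger : Set (EuclideanSpace ℝ (Fin 3)) := {a | ∀ σ ∈ Icc 0 L, ‖Φ (-σ) a‖ ≤ 2 * R} with hLinger
  set Hover : Set (EuclideanSpace ℝ (Fin 3)) := {a | L / 2 ≤ (volume {σ ∈ Icc 0 L |
      ‖selfSimilarTransport γ 0 V (Φ (-σ) a)‖ < δ R}).toReal} with hHover
  have hhov := hR₀ R hRR₀ V K Rbig hV2 hK hRbig hVU
  -- ### every lingering label hovers
  have hkey : ∀ a ∈ Linger, a ∈ Hover := by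
    intro a ha
    -- the fast time along the orbit of `a`
    have hfast := NeedleClock.volume_fastTime_le_of_linger (γ := γ) hprof hγ2 hV1 hK hRbig hVU hL0 ha (hδ R hR1)
    -- the Bernoulli gain is at most the oscillation on `B̄_{2R}`
    have h2R1 : 1 ≤ 2 * R := by linarith
    have hend : ‖Φ (-L) a‖ ≤ 2 * R := ha L ⟨hL0, le_rfl⟩
    have hstart : ‖a‖ ≤ 2 * R := by
      have h0 := ha 0 ⟨le_rfl, hL0⟩
      rwa [neg_zero, hΦ, ODE.evolutionMap_self] at h0
    have hgain : selfSimilarBernoulli γ 0 U P (Φ (-L) a) - selfSimilarBernoulli γ 0 U P a ≤ C * (2 * R) ^ θ :=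
      hosc (2 * R) h2R1 _ _ hend hstart
    -- the room condition: `C (2R)^θ / ((1−2γ) δ²) ≤ L/4`
    have hroomR := hR₁ R hRR₁
    have hδ2 : 0 < δ R ^ 2 := pow_pos (hδ R hR1) 2
    have hF : C * (2 * R) ^ θ / ((1 - 2 * γ) * δ R ^ 2) ≤ L / 4 := by
      rw [div_le_iff₀ (by positivity), Real.mul_rpow (by norm_num) hR0.le]
      have h4 : (2 : ℝ) ^ (2 + θ) = 4 * (2 : ℝ) ^ θ := by
        rw [Real.rpow_add two_pos, Real.rpow_two]; ring
      rw [h4] at hroomR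
      rw [hL]
      nlinarith [hroomR]
    have hx : (selfSimilarBernoulli γ 0 U P (Φ (-L) a) - selfSimilarBernoulli γ 0 U P a) / ((1 - 2 * γ) * δ R ^ 2) ≤
        L / 4 := (div_le_div_of_nonneg_right hgain (by positivity)).trans hF
    have hfast' : (volume {σ ∈ Icc 0 L |
        δ R ≤ ‖selfSimilarTransport γ 0 U (Φ (-σ) a)‖}).toReal ≤ L / 4 := by
      refine (ENNReal.toReal_mono ENNReal.ofReal_ne_top hfast).trans ?_
      rw [ENNReal.toReal_ofReal']
      exact max_le hx (by positivity)
    -- on lingering orbits the cut-off field is the profile field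
    have hWeq : ∀ σ ∈ Icc 0 L, selfSimilarTransport γ 0 V (Φ (-σ) a) = selfSimilarTransport γ 0 U (Φ (-σ) a) := by
      intro σ hσ
      have hin : Φ (-σ) a ∈ ball (0 : EuclideanSpace ℝ (Fin 3)) Rbig :=
        mem_ball_zero_iff.2 (lt_of_le_of_lt (ha σ hσ) hRbig)
      simp only [selfSimilarTransport_apply, hVU _ hin]
    -- slow + fast ⊇ [0, L]
    set Fast : Set ℝ := {σ ∈ Icc 0 L | δ R ≤ ‖selfSimilarTransport γ 0 U (Φ (-σ) a)‖} with hFast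
    set Slow : Set ℝ := {σ ∈ Icc 0 L | ‖selfSimilarTransport γ 0 V (Φ (-σ) a)‖ < δ R} with hSlow
    have hcover : Icc (0 : ℝ) L ⊆ Slow ∪ Fast := by
      intro σ hσ
      by_cases hlt : ‖selfSimilarTransport γ 0 V (Φ (-σ) a)‖ < δ R
      · exact Or.inl ⟨hσ, hlt⟩
      · right
        refine ⟨hσ, ?_⟩
        rw [← hWeq σ hσ]
        exact not_lt.1 hlt
    have hSlow_fin : volume Slow ≠ ⊤ :=
      ((measure_mono (fun σ hσ => hσ.1)).trans_lt (by rw [Real.volume_Icc]; exact ENNReal.ofReal_lt_top)).ne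
    have hFast_fin : volume Fast ≠ ⊤ :=
      ((measure_mono (fun σ hσ => hσ.1)).trans_lt (by rw [Real.volume_Icc]; exact ENNReal.ofReal_lt_top)).ne
    have hsum : L ≤ (volume Slow).toReal + (volume Fast).toReal := by
      have h1 : volume (Icc (0 : ℝ) L) ≤ volume Slow + volume Fast :=
        (measure_mono hcover).trans (measure_union_le _ _)
      rw [Real.volume_Icc, sub_zero] at h1
      have h2 := ENNReal.toReal_mono (ENNReal.add_ne_top.2 ⟨hSlow_fin, hFast_fin⟩) h1
      rwa [ENNReal.toReal_ofReal hL0, ENNReal.toReal_add hSlow_fin hFast_fin] at h2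
    show L / 2 ≤ (volume Slow).toReal
    linarith
  -- ### monotonicity
  have hsub : B ∩ Linger ⊆ B ∩ Linger ∩ Hover := fun a ha => ⟨ha, hkey a ha.2⟩
  have hfin : volume (B ∩ Linger ∩ Hover) ≠ ⊤ :=
    ((measure_mono (fun a ha => ha.1.1)).trans_lt measure_ball_lt_top).ne
  have hv0 : 0 ≤ (volume B).toReal := ENNReal.toReal_nonneg
  calc (volume (B ∩ Linger)).toReal ≤ (volume (B ∩ Linger ∩ Hover)).toReal := ENNReal.toReal_mono hfin (measure_mono hsub)
    _ ≤ (volume B).toReal / 4 := hhov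
    _ ≤ (volume B).toReal / 2 := by linarith

end Summit.NavierStokesRegularity.NavierStokesRegularity.Theorems.PowerGaugeEulerLiouville.NeedleRace

end
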